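import Summits.RiemannHypothesis.RiemannHypothesis.Theorems.PfPersistenceF5SignedTwins
import HarnessLib

/-!
# PF persistence, fake seat 5 — the PAIR MARGIN of THEOREM F5-PAIR is strictly positive

Unit `pub-rhpf-fake-5` (gen 5) of the `pub-rhpf` cell — mechanism / rigidity campaign; **no RH claims**.
(FAKES.md §5.8.3 (c), GAP-CLASSES row F5-SWAP-G.)

`PfPersistenceF5SignedTwins.pair_negative_or_zeta_not_positive` (THEOREM F5-PAIR) catches a signed
two-site re-weighting `(c₀, c₁)` of `ζ`'s table beyond the cutoff as soon as
`2ε‖g₁‖₂² < max(|c₀|, |c₁|)·D`, with the PAIR MARGIN `D := ‖g₁‖₂² − |A_{g₁}(Δ)|`,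
`A_{g₁}(y) = ∫ g₁(u) g₁(u − y) du` (`autocorrRe`), `Δ := log n₀ − log n₁`.  Bombieri's Lemma 2
(`abs_autocorrRe_le`) gives `D ≥ 0`; here we prove the STRICT inequality

* `abs_autocorrRe_lt` — `|A_{g₁}(Δ)| < ‖g₁‖₂²` for every `Δ ≠ 0` and every real Weil test `g₁ ≠ 0`
  (in `L²`): a non-zero compactly supported continuous function is not `±` its own translate.
  Proof: `∫ (g₁(u) − s·g₁(u − Δ))² du = (1 + s²)‖g₁‖₂² − 2s·A_{g₁}(Δ)` (`integral_sq_sub_shift`);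
  if `|A| = ‖g₁‖₂²` take `s = sign A`, so the integral vanishes, the continuous non-negative
  integrand is identically zero, `g₁(u) = s·g₁(u − Δ)` for all `u`, and iterating the shift drives any
  point of the support out of the (bounded) support (`eq_zero_of_eq_mul_shift`).

Consequences: `pairMargin_pos` (`D > 0` whenever `n₀ ≠ n₁` are genuine sites, `log nᵢ > 0`), the
positive HAIRLINE THRESHOLD `ε⋆ := max(|c₀|, |c₁|)·D / (2‖g₁‖₂²)` of a non-trivial pair
(`pairThreshold_pos`), and THEOREM F5-PAIR in threshold form
(`pair_negative_or_zeta_not_positive_of_lt_threshold`: every `ε < ε⋆` triggers the dichotomy) — so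
F5-PAIR is never vacuous: EVERY non-trivial signed pair swap beyond the cutoff is caught by the twin
windows of its sites once `ζ`'s near-extremal Rayleigh quotient `ε` on `[-b, b]` is below `ε⋆ > 0`
(or `ζ` is not Weil-positive on such a window).  The numbers `ε₁^ζ(b, N)` that make this bite are DATA
(FAKES §5.8) and are not used here.  References: E. Bombieri, Rend. Mat. Acc. Lincei (9) 11 (2000)
§4 Lemma 2 (the non-strict bound); the strictness is folklore (equality case of Cauchy–Schwarz for
translates of a compactly supported function).
-/

set_option linter.dupNamespace false  -- the mandated namespace repeats `RiemannHypothesis`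

noncomputable section

open scoped ArithmeticFunction
open Set MeasureTheory Complex Literature.NumberTheory.LFunctions
open Summit.RiemannHypothesis.RiemannHypothesis.Theorems.PfPersistenceDownCone
open Summit.RiemannHypothesis.RiemannHypothesis.Theorems.PfPersistenceF5TailTwins (twin)
open Summit.RiemannHypothesis.RiemannHypothesis.Theorems.PfPersistenceBarrier
open Summit.RiemannHypothesis.RiemannHypothesis.Theorems.PfPersistenceBarrier.ExplicitDatum
open Summit.RiemannHypothesis.RiemannHypothesis.Theorems.PfPersistenceF5SignedTwins

namespace Summit.RiemannHypothesis.RiemannHypothesis.Theorems.PfPersistenceF5PairMargin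

variable {g₁ : ℝ → ℝ} {b : ℝ}

/-! ## §1 Real-valued bookkeeping for a real Weil test -/

/-- A real function whose complexification is a Weil test is continuous. [folklore] -/
theorem continuous_of_isWeilTest (hg : IsWeilTest fun t ↦ (g₁ t : ℂ)) : Continuous g₁ := by
  have h := Complex.continuous_re.comp hg.1.continuous
  simpa [Function.comp_def] using h

/-- A real function whose complexification is a Weil test has compact support. [folklore] -/
theorem hasCompactSupport_of_isWeilTest (hg : IsWeilTest fun t ↦ (g₁ t : ℂ)) :
    HasCompactSupport g₁ := by
  have h := hg.2.comp_left (g := Complex.re) Complex.zero_re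
  simpa [Function.comp_def] using h

/-- `u ↦ g₁(u)·g₁(u − Δ)` is integrable. [folklore] -/
theorem integrable_mul_shift (hg : IsWeilTest fun t ↦ (g₁ t : ℂ)) (Δ : ℝ) :
    Integrable fun u ↦ g₁ u * g₁ (u - Δ) := by
  have hc := continuous_of_isWeilTest hg
  exact (hc.mul (hc.comp (continuous_id.sub continuous_const))).integrable_of_hasCompactSupport
    ((hasCompactSupport_of_isWeilTest hg).mul_right)

/-- `‖g₁‖₂²` written with the real square. [folklore] -/
theorem integral_norm_sq_eq (g₁ : ℝ → ℝ) :
    ∫ x, ‖(g₁ x : ℂ)‖ ^ 2 = ∫ x, g₁ x * g₁ x := by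
  refine integral_congr_ae (Filter.Eventually.of_forall fun u ↦ ?_)
  simp only [Complex.norm_real, Real.norm_eq_abs, sq_abs]
  ring

/-- **Expansion.** `∫ (g₁(u) − s·g₁(u − Δ))² du = (1 + s²)‖g₁‖₂² − 2s·A_{g₁}(Δ)`
(translation invariance of Lebesgue measure for the `s²` term). [folklore] -/
theorem integral_sq_sub_shift (hg : IsWeilTest fun t ↦ (g₁ t : ℂ)) (s Δ : ℝ) :
    ∫ u, (g₁ u - s * g₁ (u - Δ)) ^ 2 =
      (1 + s ^ 2) * (∫ x, ‖(g₁ x : ℂ)‖ ^ 2) - 2 * s * autocorrRe g₁ Δ := by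
  have h1 : Integrable fun u ↦ g₁ u * g₁ u := by
    simpa only [sub_zero] using integrable_mul_shift hg 0
  have h2 : Integrable fun u ↦ g₁ u * g₁ (u - Δ) := integrable_mul_shift hg Δ
  have h3 : Integrable fun u ↦ g₁ (u - Δ) * g₁ (u - Δ) := by
    simpa only [sub_zero] using (h1.comp_sub_right Δ)
  have hshift : ∫ u, g₁ (u - Δ) * g₁ (u - Δ) = ∫ u, g₁ u * g₁ u :=
    integral_sub_right_eq_self (fun u ↦ g₁ u * g₁ u) Δ
  have hexp : (fun u ↦ (g₁ u - s * g₁ (u - Δ)) ^ 2) =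
      fun u ↦ (g₁ u * g₁ u - (2 * s) * (g₁ u * g₁ (u - Δ))) + s ^ 2 * (g₁ (u - Δ) * g₁ (u - Δ)) := by
    funext u; ring
  have h2c : Integrable fun u ↦ 2 * s * (g₁ u * g₁ (u - Δ)) := h2.const_mul _
  have h3c : Integrable fun u ↦ s ^ 2 * (g₁ (u - Δ) * g₁ (u - Δ)) := h3.const_mul _
  have h12 : Integrable fun u ↦ g₁ u * g₁ u - 2 * s * (g₁ u * g₁ (u - Δ)) := h1.sub h2c
  rw [hexp, integral_add h12 h3c, integral_sub h1 h2c, integral_const_mul, integral_const_mul, hshift,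
    integral_norm_sq_eq, autocorrRe_eq_integral]
  ring

/-- **A compactly supported function that is `±` its own non-trivial translate vanishes.**
If `f(u) = s·f(u − Δ)` for all `u` with `s² = 1`, `Δ ≠ 0`, then `f = 0`. [folklore] -/
theorem eq_zero_of_eq_mul_shift {f : ℝ → ℝ} (hK : HasCompactSupport f) {s Δ : ℝ} (hs : s ^ 2 = 1)
    (hΔ : Δ ≠ 0) (h : ∀ u, f u = s * f (u - Δ)) (u : ℝ) : f u = 0 := by
  obtain ⟨R, hR⟩ := (Metric.isBounded_iff_subset_closedBall (0 : ℝ)).1 hK.isCompact.isBounded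
  have hsupp : ∀ v, f v ≠ 0 → |v| ≤ R := by
    intro v hv
    have hv' : v ∈ Metric.closedBall (0 : ℝ) R := hR (subset_tsupport f hv)
    simpa [Metric.mem_closedBall, Real.dist_eq] using hv'
  have hs0 : s ≠ 0 := by rintro rfl; norm_num at hs
  by_contra hu
  -- iterate the shift: `f (u - k Δ) ≠ 0` for every `k`
  have hiter : ∀ k : ℕ, f (u - k * Δ) ≠ 0 := by
    intro k
    induction k with
    | zero => simpa using hu
    | succ k ih =>
      intro hk
      apply ih
      rw [h (u - k * Δ)]
      have : u - (k : ℝ) * Δ - Δ = u - ((k + 1 : ℕ) : ℝ) * Δ := by push_cast; ring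
      rw [this, hk, mul_zero]
  -- choose `k` with `k |Δ| > R + |u|`
  have hΔpos : 0 < |Δ| := abs_pos.2 hΔ
  set k : ℕ := ⌈(R + |u|) / |Δ|⌉₊ + 1 with hkdef
  have hklt : (R + |u|) / |Δ| < k := by
    have h1 : (R + |u|) / |Δ| ≤ ⌈(R + |u|) / |Δ|⌉₊ := Nat.le_ceil _
    have h2 : ((⌈(R + |u|) / |Δ|⌉₊ : ℕ) : ℝ) < k := by rw [hkdef]; push_cast; linarith
    linarith
  have hkΔ : R + |u| < k * |Δ| := (div_lt_iff₀ hΔpos).1 hklt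
  have hfar : R < |u - k * Δ| := by
    have h1 : |(k : ℝ) * Δ| - |u| ≤ |u - k * Δ| := by
      rw [abs_sub_comm u]; exact abs_sub_abs_le_abs_sub _ _
    rw [abs_mul, Nat.abs_cast] at h1
    linarith
  exact absurd (hsupp _ (hiter k)) (not_le.2 hfar)

/-! ## §2 Strictness of Bombieri's Lemma 2 off the diagonal -/

/-- **Strict Cauchy–Schwarz for translates.** `|A_{g₁}(Δ)| < ‖g₁‖₂²` for `Δ ≠ 0`, `‖g₁‖₂ > 0`.
[folklore] (non-strict form: [cite: Bombieri2000Weil, §4 Lemma 2]) -/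
theorem abs_autocorrRe_lt (hg : IsWeilTest fun t ↦ (g₁ t : ℂ)) {Δ : ℝ} (hΔ : Δ ≠ 0)
    (hpos : 0 < ∫ x, ‖(g₁ x : ℂ)‖ ^ 2) : |autocorrRe g₁ Δ| < ∫ x, ‖(g₁ x : ℂ)‖ ^ 2 := by
  refine lt_of_le_of_ne (abs_autocorrRe_le hg Δ) fun heq ↦ ?_
  obtain ⟨s, hs1, hsA⟩ : ∃ s : ℝ, s ^ 2 = 1 ∧ s * autocorrRe g₁ Δ = |autocorrRe g₁ Δ| := by
    rcases le_or_gt 0 (autocorrRe g₁ Δ) with h | h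
    · exact ⟨1, by norm_num, by rw [one_mul, abs_of_nonneg h]⟩
    · exact ⟨-1, by norm_num, by rw [abs_of_neg h]; ring⟩
  -- the square integral vanishes
  have hint : ∫ u, (g₁ u - s * g₁ (u - Δ)) ^ 2 = 0 := by
    rw [integral_sq_sub_shift hg s Δ, hs1]
    have : 2 * s * autocorrRe g₁ Δ = 2 * |autocorrRe g₁ Δ| := by rw [← hsA]; ring
    rw [this, heq]; ring
  -- hence the continuous non-negative integrand vanishes identically
  have hc := continuous_of_isWeilTest hg
  have hcs : Continuous fun u ↦ g₁ u - s * g₁ (u - Δ) :=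
    hc.sub (continuous_const.mul (hc.comp (continuous_id.sub continuous_const)))
  have h1 : Integrable fun u ↦ g₁ u * g₁ u := by
    simpa only [sub_zero] using integrable_mul_shift hg 0
  have h2 : Integrable fun u ↦ g₁ u * g₁ (u - Δ) := integrable_mul_shift hg Δ
  have h3 : Integrable fun u ↦ g₁ (u - Δ) * g₁ (u - Δ) := by
    simpa only [sub_zero] using (h1.comp_sub_right Δ)
  have hfi : Integrable fun u ↦ (g₁ u - s * g₁ (u - Δ)) ^ 2 := by
    refine ((h1.sub (h2.const_mul (2 * s))).add (h3.const_mul (s ^ 2))).congr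
      (Filter.Eventually.of_forall fun u ↦ ?_)
    simp only [Pi.add_apply, Pi.sub_apply]
    ring
  have hae : (fun u ↦ (g₁ u - s * g₁ (u - Δ)) ^ 2) =ᵐ[volume] 0 :=
    (integral_eq_zero_iff_of_nonneg (fun u ↦ sq_nonneg _) hfi).1 hint
  have hfun : (fun u ↦ (g₁ u - s * g₁ (u - Δ)) ^ 2) = 0 :=
    (Continuous.ae_eq_iff_eq volume (hcs.pow 2) continuous_const).1 hae
  have hshift : ∀ u, g₁ u = s * g₁ (u - Δ) := by
    intro u
    have hu := congrFun hfun u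
    simp only [Pi.zero_apply, ne_eq, OfNat.ofNat_ne_zero, not_false_eq_true, pow_eq_zero_iff] at hu
    linarith
  -- so `g₁ = 0`, contradicting `‖g₁‖₂ > 0`
  have hzero : ∀ u, g₁ u = 0 :=
    eq_zero_of_eq_mul_shift (hasCompactSupport_of_isWeilTest hg) hs1 hΔ hshift
  have : ∫ x, ‖(g₁ x : ℂ)‖ ^ 2 = 0 := by simp [hzero]
  exact absurd this hpos.ne'

/-- **The pair margin is positive.** For genuine distinct sites `n₀ ≠ n₁` (`log nᵢ > 0`) and a real
Weil test `g₁ ≠ 0`: `D = ‖g₁‖₂² − |A_{g₁}(log n₀ − log n₁)| > 0`. [folklore] -/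
theorem pairMargin_pos (hg : IsWeilTest fun t ↦ (g₁ t : ℂ)) (hpos : 0 < ∫ x, ‖(g₁ x : ℂ)‖ ^ 2)
    {n₀ n₁ : ℕ} (hne : n₁ ≠ n₀) (h₀ : 0 < Real.log n₀) (h₁ : 0 < Real.log n₁) :
    0 < (∫ x, ‖(g₁ x : ℂ)‖ ^ 2) - |autocorrRe g₁ (Real.log n₀ - Real.log n₁)| := by
  have hn : ∀ n : ℕ, 0 < Real.log n → (0 : ℝ) < n := by
    intro n hn
    rcases Nat.eq_zero_or_pos n with rfl | hp
    · simp at hn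
    · exact_mod_cast hp
  have hΔ : Real.log n₀ - Real.log n₁ ≠ 0 := by
    intro h
    have hlog : Real.log (n₀ : ℝ) = Real.log (n₁ : ℝ) := by linarith
    have := Real.log_injOn_pos (hn n₀ h₀) (hn n₁ h₁) hlog
    exact hne (by exact_mod_cast this.symm)
  have := abs_autocorrRe_lt hg hΔ hpos
  linarith

/-! ## §3 THEOREM F5-PAIR in threshold form -/

/-- **The hairline threshold of a non-trivial pair is positive**:
`ε⋆ := max(|c₀|, |c₁|)·D / (2‖g₁‖₂²) > 0`. [folklore] -/
theorem pairThreshold_pos (hg : IsWeilTest fun t ↦ (g₁ t : ℂ)) (hpos : 0 < ∫ x, ‖(g₁ x : ℂ)‖ ^ 2)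
    {n₀ n₁ : ℕ} (hne : n₁ ≠ n₀) (h₀ : 0 < Real.log n₀) (h₁ : 0 < Real.log n₁) {c₀ c₁ : ℝ}
    (hc : 0 < max |c₀| |c₁|) :
    0 < max |c₀| |c₁| * ((∫ x, ‖(g₁ x : ℂ)‖ ^ 2) - |autocorrRe g₁ (Real.log n₀ - Real.log n₁)|) /
      (2 * ∫ x, ‖(g₁ x : ℂ)‖ ^ 2) :=
  div_pos (mul_pos hc (pairMargin_pos hg hpos hne h₀ h₁)) (by positivity)

/-- **THEOREM F5-PAIR, threshold form (never vacuous).** Two sites `n₁ ≠ n₀` beyond the cutoff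
(`2b < log nᵢ`), a real table `w'` equal to `ζ`'s off `{n₀, n₁}` with `(c₀, c₁) ≠ (0, 0)`, a real
Weil test `g₁ ≠ 0` in `[-b, b]` with Rayleigh bound `Re Q_ζ(g₁) ≤ ε‖g₁‖₂²`: for EVERY
`ε < ε⋆ = max(|c₀|, |c₁|)·D/(2‖g₁‖₂²)` (a positive number, `pairThreshold_pos`), at one of the two
twin windows `log nᵢ/2 + b` either `ζ` is not Weil-positive or `w'` has a negative twin direction.
[cite: Bombieri2000Weil, §4] -/
theorem pair_negative_or_zeta_not_positive_of_lt_threshold {w' : ℕ → ℝ} {n₀ n₁ : ℕ} {ε : ℝ}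
    (hb : 0 < b) (hne : n₁ ≠ n₀) (hb1 : 2 * b < Real.log n₁) (hb0 : 2 * b < Real.log n₀)
    (hoff : ∀ n : ℕ, n ≠ n₁ → n ≠ n₀ → w' n = zetaTable n)
    (hg : IsWeilTest fun t ↦ (g₁ t : ℂ)) (hs : tsupport (fun t ↦ (g₁ t : ℂ)) ⊆ Icc (-b) b)
    (hpos : 0 < ∫ x, ‖(g₁ x : ℂ)‖ ^ 2)
    (hq : (weilQuadratic fun t ↦ (g₁ t : ℂ)).re ≤ ε * ∫ x, ‖(g₁ x : ℂ)‖ ^ 2)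
    (hε : ε < max |w' n₀ - zetaTable n₀| |w' n₁ - zetaTable n₁| *
      ((∫ x, ‖(g₁ x : ℂ)‖ ^ 2) - |autocorrRe g₁ (Real.log n₀ - Real.log n₁)|) /
        (2 * ∫ x, ‖(g₁ x : ℂ)‖ ^ 2)) :
    ∃ m ∈ ({n₀, n₁} : Finset ℕ), ¬ WeilPositivityOn (Real.log m / 2 + b) ∨
      ∃ σ : ℝ, σ ^ 2 = 1 ∧
        ((tableDatum w').quadratic (twin (Real.log m / 2) σ fun t ↦ (g₁ t : ℂ))).re < 0 := by
  refine pair_negative_or_zeta_not_positive hb hne hb1 hb0 hoff hg hs hq ?_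
  have h2 : (0 : ℝ) < 2 * ∫ x, ‖(g₁ x : ℂ)‖ ^ 2 := by positivity
  have := (lt_div_iff₀ h2).1 hε
  linarith

/-- **Corollary (every non-trivial pair has a positive threshold).** Packaging of the two previous
statements: for two genuine sites beyond the cutoff and `(c₀, c₁) ≠ (0, 0)` there is `ε⋆ > 0` such that
every admissible `ε < ε⋆` triggers the F5-PAIR dichotomy. [folklore] -/
theorem pair_exists_threshold {w' : ℕ → ℝ} {n₀ n₁ : ℕ} (hb : 0 < b) (hne : n₁ ≠ n₀)
    (hb1 : 2 * b < Real.log n₁) (hb0 : 2 * b < Real.log n₀)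
    (hoff : ∀ n : ℕ, n ≠ n₁ → n ≠ n₀ → w' n = zetaTable n)
    (hc : 0 < max |w' n₀ - zetaTable n₀| |w' n₁ - zetaTable n₁|)
    (hg : IsWeilTest fun t ↦ (g₁ t : ℂ)) (hs : tsupport (fun t ↦ (g₁ t : ℂ)) ⊆ Icc (-b) b)
    (hpos : 0 < ∫ x, ‖(g₁ x : ℂ)‖ ^ 2) :
    ∃ εs : ℝ, 0 < εs ∧ ∀ ε : ℝ, ε < εs →
      (weilQuadratic fun t ↦ (g₁ t : ℂ)).re ≤ ε * (∫ x, ‖(g₁ x : ℂ)‖ ^ 2) →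
      ∃ m ∈ ({n₀, n₁} : Finset ℕ), ¬ WeilPositivityOn (Real.log m / 2 + b) ∨
        ∃ σ : ℝ, σ ^ 2 = 1 ∧
          ((tableDatum w').quadratic (twin (Real.log m / 2) σ fun t ↦ (g₁ t : ℂ))).re < 0 := by
  have h₀ : 0 < Real.log n₀ := by linarith
  have h₁ : 0 < Real.log n₁ := by linarith
  exact ⟨_, pairThreshold_pos hg hpos hne h₀ h₁ hc, fun ε hε hq ↦
    pair_negative_or_zeta_not_positive_of_lt_threshold hb hne hb1 hb0 hoff hg hs hpos hq hε⟩

end Summit.RiemannHypothesis.RiemannHypothesis.Theorems.PfPersistenceF5PairMargin
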